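import Summits.HubbardSuperconductivity.HubbardSuperconductivity.Theorems.PerWidthThermodynamics.Negative.PerWidthThermodynamicsTwoColumnGauge

/-!
# Crux `PerWidthThermodynamics` (item `stmt-HubbardSuperconductivity-18510`, route SeamInduction):
# load-bearing analysis of the side conditions `M ≤ L` and `L₁ ≤ L`

Negative-side lemmas of the standing disprover (cdisprove cycle 1), over the named functionals of
`PerWidthThermodynamicsTwoColumnGauge.lean` (`stiff`, `icomp`; `perWidthThermodynamics_iff` certifies
that the crux is the statement over them). No definition is introduced; the two mutated
statements are spelled out inside the theorems.

* `perWidthThermodynamics_iff_withoutML` — deleting the hypothesis `M ≤ L` does not change the crux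
  (`L₁ ↦ max L₁ M`): it is decoration.
* `perWidthThermodynamics_false_without_L₁` — deleting the cut-off `L₁` (both bounds asked for ALL
  even `L ≥ M`) makes the crux FALSE: by the two-column gauge (`stiff_two_eq_zero`) the width-2
  member has stiffness functional `0 < d` at `L = 2` (witness `M = L = 2`, any `U, δ`, carrier
  `Fin 4`). Any proof of the crux must use `L₁ ≥ 4`.

Workfile with the full attack log: `Cruxes/PerWidthThermodynamics/Disproof.lean`.
-/

set_option linter.dupNamespace false

noncomputable section

namespace Summit.HubbardSuperconductivity.HubbardSuperconductivity.Theorems.PerWidthThermodynamics.Negative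

open Matrix Finset Literature.MathematicalPhysics.QuantumLattice

/-- **`M ≤ L` is decoration.** The crux is equivalent to its variant without the hypothesis
`M ≤ L` (replace the cut-off `L₁` by `max L₁ M`). Information for provers: nothing may be drawn
from `M ≤ L` that is not already drawn from `L₁ ≤ L`. -/
theorem perWidthThermodynamics_iff_withoutML :
    Theses.SeamInduction.PerWidthThermodynamics ↔
      ∃ U : ℝ, 0 < U ∧ ∃ δ ∈ Set.Ioo (0 : ℝ) (3 / 10), ∀ (M : ℕ) [NeZero M], Even M → 2 ≤ M →
        ∃ d : ℝ, 0 < d ∧ ∃ k : ℝ, ∃ L₁ : ℕ, ∀ (L : ℕ) [NeZero L], Even L → L₁ ≤ L →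
          ∀ (Λ : Type) [LinearOrder Λ] [Fintype Λ] (e : Λ ≃ ZMod L × ZMod M),
            d ≤ stiff L M Λ e U δ ∧ 0 < icomp L M Λ e U δ ∧ icomp L M Λ e U δ ≤ k := by
  rw [perWidthThermodynamics_iff]
  constructor
  · rintro ⟨U, hU, δ, hδ, h⟩
    refine ⟨U, hU, δ, hδ, fun M _ hMe hM2 => ?_⟩
    obtain ⟨d, hd, k, L₁, h1⟩ := h M hMe hM2
    exact ⟨d, hd, k, max L₁ M, fun L _ hLe hL Λ _ _ e =>
      h1 L hLe ((le_max_right _ _).trans hL) ((le_max_left _ _).trans hL) Λ e⟩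
  · rintro ⟨U, hU, δ, hδ, h⟩
    refine ⟨U, hU, δ, hδ, fun M _ hMe hM2 => ?_⟩
    obtain ⟨d, hd, k, L₁, h1⟩ := h M hMe hM2
    exact ⟨d, hd, k, L₁, fun L _ hLe _ hL Λ _ _ e => h1 L hLe hL Λ e⟩

/-- **`L₁ ≤ L` is load-bearing.** The crux with the cut-off `L₁` deleted — the stiffness floor and
the compressibility window asked for ALL even `L ≥ M` — is FALSE: at `M = L = 2` the seam twist is
a pure gauge, so the stiffness functional vanishes (`stiff_two_eq_zero`) while `0 < d` is required.
Witness: any `U, δ`; carrier `Fin 4 ≃ ℤ/2 × ℤ/2`. Hence any proof of the crux must use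
`L₁ ≥ 4`. -/
theorem perWidthThermodynamics_false_without_L₁ :
    ¬ ∃ U : ℝ, 0 < U ∧ ∃ δ ∈ Set.Ioo (0 : ℝ) (3 / 10), ∀ (M : ℕ) [NeZero M], Even M → 2 ≤ M →
        ∃ d : ℝ, 0 < d ∧ ∃ k : ℝ, ∀ (L : ℕ) [NeZero L], Even L → M ≤ L →
          ∀ (Λ : Type) [LinearOrder Λ] [Fintype Λ] (e : Λ ≃ ZMod L × ZMod M),
            d ≤ stiff L M Λ e U δ ∧ 0 < icomp L M Λ e U δ ∧ icomp L M Λ e U δ ≤ k := by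
  rintro ⟨U, -, δ, -, h⟩
  obtain ⟨d, hd, k, h1⟩ := h 2 even_two le_rfl
  obtain ⟨h2, -, -⟩ := h1 2 even_two le_rfl (Fin (2 * 2))
    (finProdFinEquiv.symm.trans
      (Equiv.prodCongr (ZMod.finEquiv 2).toEquiv (ZMod.finEquiv 2).toEquiv))
  rw [stiff_two_eq_zero] at h2
  exact absurd h2 (not_le.mpr hd)

end Summit.HubbardSuperconductivity.HubbardSuperconductivity.Theorems.PerWidthThermodynamics.Negative
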